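import Literature.NumberTheory.Transcendental.ManyCurveThetaWronskian
import Literature.NumberTheory.Transcendental.ZeroEstMain
import Literature.NumberTheory.Transcendental.ZeroEstStdBridge
import Literature.NumberTheory.Transcendental.PkappaAnalyticGroupModel
import Literature.Analysis.Complex.OsgoodProofs
import HarnessLib

/-!
# The `k`-lattice theta model as an analytic group model, and the zero estimate on it

Topic `Literature/NumberTheory/Transcendental`; unit
`provefact-Literature.NumberTheory.Transcendental.H-0a3eb64689` (fact
`Literature.NumberTheory.Transcendental.HuberWustholzManyCurvePeriods`, `ManyCurvePeriods.lean`).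
It introduces NO named fact. Lattice-family counterpart of the two-lattice `TwoCurveThetaModel.lean`
(port of `PkappaAnalyticGroupModel.lean` and of the counting lemma of `ZeroEstStdBridge.lean`), for
the theta model of the family standard models `M = 𝔾ₘ^β × P` (`ManyCurveTheta.lean`; lattice
family `L : 𝓙 → PeriodPair`, class map `cls : γ → 𝓙`):

* `Θf`, `eval_Θf_rename`, `HardData`, `bdryForms`, `exists_chart_ne_zero`, `lawf`,
  `thetaModel (H : HardData) : AnalyticGroupModel (Lie M_ℂ) N` (soft data from
  `ManyCurveThetaLaws.lean`: the finite complete family of analytic laws), `zero_estimate_theta`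
  (the abstract `AnalyticGroupModel.zero_estimate` of `ZeroEstMain.lean` specialised),
  `ncard_image_vadd_multiples_eq_orbitCard`, `philippon_shape_of_classification`;
* **the hard geometric data SUPPLIED** (`hardData`): `hard_surj` (image theorem,
  `ManyCurveThetaTangent.theta_surj'`), `hard_locRel` (Jacobian criterion, `theta_locRel`,
  transported along the indexing equivalence by `pderiv_rename` and `LinearEquiv.funCongrLeft`),
  `hard_nondeg` (`exists_nondeg_point`), `wronskf`/`F_wronskf` (`F_wronsk`), all reindexed by
  `Fin (N + 1)`;
* **`philippon_shape_of_classification'`** — Philippon's zero estimate (1986, Thm. 2.1) for the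
  family theta model `(L, cls, κ, β, γ, δ)` in the shape of the tree's named fact
  `philippon1986_std` (obstruction data `GaGmEFam.Std.SubgroupDataC`, `orbitCard`), granted ONLY the
  classification `hCL` of the closed irreducible subgroups of `Lie M_ℂ` for the theta-Zariski
  topology (the sequel's business; it needs `Hom(E_i, E_j) = 0` for `i ≠ j` and, on the CM
  classes, a single block).

## References

* P. Philippon, *Lemmes de zéros dans les groupes algébriques commutatifs*, Bull. Soc. Math.
  France 114 (1986), 355–383, Thm. 2.1. [Philippon1986]
* Yu. V. Nesterenko, P. Philippon (eds.), *Introduction to Algebraic Independence Theory*,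
  LNM 1752, Springer 2001, Ch. 11 (D. Roy), §2.1–§2.3, Lemma 3.1, Thm. 4.1. [NesterenkoPhilippon2001]
* A. Huber, G. Wüstholz, *Transcendence and Linear Relations of 1-Periods*, CUP 2022, Thm. 15.3.
  [HuberWustholz2022]
-/

noncomputable section

open MvPolynomial Set Module
open scoped Pointwise

namespace Literature.NumberTheory.Transcendental

namespace GaGmEFam

namespace Std

open GaGmE (Kbar)
open GaGmE.Std (iy iz is coords coords_iy coords_iz coords_is ThetaIdx thetaT thetaT_none thetaT_some
  nIdx nIdx_succ idxEquiv coeff_rename_equiv bdryForm eval_bdryForm bdryForms isHomogeneous_of_mem_bdryForms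
  VanishesAlong)

variable {𝓙 : Type} [DecidableEq 𝓙] {β γ δ : Type} [Fintype β] [Fintype γ] [Fintype δ] [DecidableEq γ]
variable (L : 𝓙 → PeriodPair) (cls : γ → 𝓙) (κM : δ → γ → Kbar)

/-! ### Indexing the theta functions by `Fin (N + 1)` -/

/-- The theta functions indexed by `Fin (N + 1)`. [folklore] -/
def Θf (J : Fin (nIdx β γ δ + 1)) (w : β ⊕ (γ ⊕ δ) → ℂ) : ℂ := theta L cls κM (idxEquiv β γ δ J) w

omit [DecidableEq 𝓙] in
/-- Evaluation at `Θ(w)` of a transported polynomial is `thetaEval`. [folklore] -/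
theorem eval_Θf_rename (P : MvPolynomial (Option β × ThetaIdx γ δ) ℂ) (w : β ⊕ (γ ⊕ δ) → ℂ) :
    eval (fun J => Θf L cls κM J w) (rename (idxEquiv β γ δ).symm P) = thetaEval L cls κM P w := by
  simp only [eval_rename, thetaEval, Θf, Function.comp_def, Equiv.apply_symm_apply]

/-! ### The hard geometric data of the embedding -/

/-- **The hard geometric inputs on the theta embedding** (to be PROVED in the sequel; here a
datum): surjectivity of `w ↦ [Θ(w)]` onto the points of `M̄_κ` off the boundary
`∏_a X_{(a,(M,none))} = 0`, the Jacobian criterion at every point, one point with `n` coordinate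
ratios of injective differential, and the quadratic Wronskian forms of the invariant derivations.
[cite: NesterenkoPhilippon2001, Ch. 11 §2.1–§2.3, Lemma 3.1] -/
structure HardData where
  /-- Surjectivity onto the closure off the boundary. -/
  surj : ∀ x : Fin (nIdx β γ δ + 1) → ℂ,
    (∀ (P : MvPolynomial (Fin (nIdx β γ δ + 1)) ℂ) (d : ℕ), P.IsHomogeneous d →
      (∀ w, eval (fun J => Θf L cls κM J w) P = 0) → eval x P = 0) →
    (∃ u ∈ (Finset.univ : Finset (γ → Fin 3)).image
        (fun Mc => ∏ a : Option β, (X ((idxEquiv β γ δ).symm (a, (Mc, none))) : MvPolynomial _ ℂ)),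
      eval x u ≠ 0) →
    ∃ (c : ℂ) (w : β ⊕ (γ ⊕ δ) → ℂ), x = c • fun J => Θf L cls κM J w
  /-- Jacobian criterion at every point. -/
  locRel : ∀ w : β ⊕ (γ ⊕ δ) → ℂ, ∃ S : Finset (MvPolynomial (Fin (nIdx β γ δ + 1)) ℂ),
    (∀ P ∈ S, ∃ d, P.IsHomogeneous d) ∧ (∀ P ∈ S, ∀ w', eval (fun J => Θf L cls κM J w') P = 0) ∧
    S.card + Fintype.card (β ⊕ (γ ⊕ δ)) = nIdx β γ δ ∧
    LinearIndependent ℂ fun P : S => fun J => eval (fun J' => Θf L cls κM J' w) (pderiv J (P : MvPolynomial _ ℂ))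
  /-- One point of injective differential. -/
  nondeg : ∃ (w₀ : β ⊕ (γ ⊕ δ) → ℂ) (J₀ : Fin (nIdx β γ δ + 1))
      (Js : Fin (Fintype.card (β ⊕ (γ ⊕ δ))) → Fin (nIdx β γ δ + 1)), Θf L cls κM J₀ w₀ ≠ 0 ∧
    ∀ x : β ⊕ (γ ⊕ δ) → ℂ,
      (∀ i, deriv (fun t : ℂ => Θf L cls κM (Js i) (w₀ + t • x) / Θf L cls κM J₀ (w₀ + t • x)) 0 = 0) → x = 0
  /-- The Wronskian forms. -/
  wronsk : (β ⊕ (γ ⊕ δ) → ℂ) → Fin (nIdx β γ δ + 1) → Fin (nIdx β γ δ + 1) →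
    MvPolynomial (Fin (nIdx β γ δ + 1)) ℂ
  /-- They are quadratic. -/
  isHomogeneous_wronsk : ∀ x I J, (wronsk x I J).IsHomogeneous 2
  /-- `Θ_J ∂_xΘ_I - Θ_I ∂_xΘ_J = Q_{x,I,J}(Θ)`. -/
  F_wronsk : ∀ x I J w, Θf L cls κM J w * deriv (fun t : ℂ => Θf L cls κM I (w + t • x)) 0 -
    Θf L cls κM I w * deriv (fun t : ℂ => Θf L cls κM J (w + t • x)) 0 = eval (fun K => Θf L cls κM K w) (wronsk x I J)

/-! ### The soft data -/

omit [Fintype β] [Fintype δ] in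
omit [DecidableEq 𝓙] in
/-- **At every point some chart `M` has all `Θ_{(a,(M,none))}(w) ≠ 0`**: `M b = 2` on the
lattice points, `M b = 0` off them. [folklore] -/
theorem exists_chart_ne_zero (w : β ⊕ (γ ⊕ δ) → ℂ) :
    ∃ Mc : γ → Fin 3, ∀ a : Option β, theta L cls κM (a, (Mc, none)) w ≠ 0 := by
  classical
  let Mc : γ → Fin 3 := fun b => if w (iz b) ∈ (L (cls b)).lattice then 2 else 0
  have hM : ∀ b, (L (cls b)).univExtP (Mc b) (w (iz b)) ≠ 0 := by
    intro b
    by_cases hb : w (iz b) ∈ (L (cls b)).lattice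
    · obtain ⟨m', n', hmn⟩ := PeriodPair.mem_lattice.mp hb
      obtain ⟨c, hc, -, -, h2, -⟩ := (L (cls b)).exists_univExtTheta_lattice m' n' 0
      simp only [PeriodPair.univExtTheta_inl] at h2
      have : Mc b = 2 := if_pos hb
      rw [this, ← hmn, h2]
      exact mul_ne_zero hc (by norm_num)
    · have : Mc b = 0 := if_neg hb
      rw [this, (PeriodPair.univExtP_eq hb).1]
      exact pow_ne_zero _ ((L (cls b)).weierstrassSigma_ne_zero hb)
  refine ⟨Mc, fun a => ?_⟩
  have hP : thetaPnone (β := β) (δ := δ) L cls Mc w ≠ 0 := Finset.prod_ne_zero_iff.mpr fun b _ => hM b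
  rcases a with _ | j
  · simpa [theta] using hP
  · simp only [theta, thetaT_some, thetaP_none]
    exact mul_ne_zero (Complex.exp_ne_zero _) hP

/-- The laws transported to `Fin (N + 1)`: `A^α_I(X, v) = lawPoly(s_α, v)_{I}`. [folklore] -/
def lawf (α : Fin (2 * Fintype.card γ + 1)) (I : Fin (nIdx β γ δ + 1)) (v : β ⊕ (γ ⊕ δ) → ℂ) :
    MvPolynomial (Fin (nIdx β γ δ + 1)) ℂ :=
  rename (idxEquiv β γ δ).symm (lawPoly L cls κM (auxPt L cls α) v (idxEquiv β γ δ I))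

/-- **The theta model of `M_κ` as an analytic group model.** [cite: NesterenkoPhilippon2001, Ch. 11 §2.1 (84)] -/
def thetaModel (H : HardData (β := β) L cls κM) : AnalyticGroupModel (β ⊕ (γ ⊕ δ) → ℂ) (nIdx β γ δ) where
  Θ := fun J w => Θf L cls κM J w
  analyticOnNhd_Θ J := analyticOnNhd_theta L cls κM _
  exists_Θ_ne_zero w := by
    obtain ⟨J, hJ⟩ := exists_theta_ne_zero L cls κM w
    exact ⟨(idxEquiv β γ δ).symm J, by simpa [Θf] using hJ⟩
  nLaw := 2 * Fintype.card γ + 1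
  lawDeg := 4
  lawDeg_pos := by norm_num
  law := fun α I v => lawf L cls κM α I v
  isHomogeneous_law α I v := (lawPoly_isHomogeneous L cls κM _ v _).rename_isHomogeneous
  differentiable_coeff_law α I m := by
    simp only [lawf, coeff_rename_equiv]
    exact coeffDifferentiable_lawPoly L cls κM (auxPt L cls α) (idxEquiv β γ δ I) _
  lam α u v := lawUnit (β := β) (δ := δ) L cls (auxPt L cls α) u v
  analyticOnNhd_lam α := by
    have hd := differentiable_lawUnit (β := β) (γ := γ) (δ := δ) L cls (auxPt L cls α)
    exact Literature.Analysis.Complex.SCV.analyticOnNhd_of_differentiableOn hd.differentiableOn isOpen_univ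
  eval_law α I u v := by
    show eval (fun J => Θf L cls κM J u) (lawf L cls κM α I v) = lawUnit L cls (auxPt L cls α) u v * Θf L cls κM I (u + v)
    rw [lawf, eval_Θf_rename, thetaEval_lawPoly]
    rfl
  exists_lam_ne_zero u v := exists_lawUnit_auxPt_ne_zero L cls u v
  bdry := bdryForms
  isHomogeneous_bdry u hu := ⟨_, Fintype.card_pos (α := Option β), isHomogeneous_of_mem_bdryForms hu⟩
  exists_bdry_ne_zero w := by
    classical
    obtain ⟨Mc, hMc⟩ := exists_chart_ne_zero L cls κM w
    refine ⟨_, Finset.mem_image_of_mem _ (Finset.mem_univ Mc), ?_⟩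
    rw [eval_prod]
    exact Finset.prod_ne_zero_iff.mpr fun a _ => by simpa [Θf] using hMc a
  surj := H.surj
  dim := Fintype.card (β ⊕ (γ ⊕ δ))
  finrank_eq := Module.finrank_fintype_fun_eq_card ℂ
  locRel := H.locRel
  nondeg := H.nondeg
  wronsk := H.wronsk
  isHomogeneous_wronsk := H.isHomogeneous_wronsk
  F_wronsk := H.F_wronsk

omit [DecidableEq 𝓙] in
/-- `F_{P'} = thetaEval P` for the transported form `P' = rename e⁻¹ P`. [folklore] -/
theorem F_thetaModel_rename (H : HardData (β := β) L cls κM) (P : MvPolynomial (Option β × ThetaIdx γ δ) ℂ) (w : β ⊕ (γ ⊕ δ) → ℂ) :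
    (thetaModel L cls κM H).F (rename (idxEquiv β γ δ).symm P) w = thetaEval L cls κM P w :=
  eval_Θf_rename L cls κM P w

/-! ### The zero estimate on `M_κ` -/

omit [DecidableEq 𝓙] in
/-- **Philippon's zero estimate on `M_κ = 𝔾ₘ^β × P_κ`** (theta embedding), with the obstruction a
closed irreducible subgroup `H₀ ⊆ Lie M_κ,ℂ` of the theta-Zariski topology: for a subspace `𝔟`,
a point `v`, a form `P` of degree `D` with `F_P ≢ 0`, and `S, T`, if `F_P` vanishes to order
`≥ nT + 1` along `𝔟` at `s v` for `0 ≤ s ≤ nS`, then for some such `H₀` and some `v₀` with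
`F_P(v₀ + H₀) = 0`,
`binom(T + e, e) · card{σ + H₀ ; σ ∈ Σ} · D^{coneDim H₀ - 1} ≤ c · Dⁿ`,
`e = dim 𝔟 - dim(𝔟 ∩ 𝒯(H₀))`, `c = mainConst`. [cite: Philippon1986, Thm. 2.1]
[cite: NesterenkoPhilippon2001, Ch. 11 Thm. 4.1] -/
theorem zero_estimate_theta (H : HardData (β := β) L cls κM) (𝔟 : Submodule ℂ (β ⊕ (γ ⊕ δ) → ℂ)) (v : β ⊕ (γ ⊕ δ) → ℂ)
    {P : MvPolynomial (Option β × ThetaIdx γ δ) ℂ} {D : ℕ} (S T : ℕ) (hP : P.IsHomogeneous D)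
    (hP0 : ∃ w, thetaEval L cls κM P w ≠ 0)
    (hvan : ∀ s : ℕ, s ≤ Fintype.card (β ⊕ (γ ⊕ δ)) * S →
      VanishesAlong 𝔟 (thetaEval L cls κM P) ((s : ℂ) • v) (Fintype.card (β ⊕ (γ ⊕ δ)) * T + 1)) :
    ∃ H₀ : AddSubgroup (β ⊕ (γ ⊕ δ) → ℂ), (thetaModel L cls κM H).IsIrred (H₀ : Set (β ⊕ (γ ⊕ δ) → ℂ)) ∧
      (∃ v₀, ∀ h ∈ H₀, thetaEval L cls κM P (v₀ + h) = 0) ∧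
      (T + (finrank ℂ 𝔟 - finrank ℂ ↥(𝔟 ⊓ AnalyticGroupModel.linSpace ((H₀ : AddSubgroup _) : Set (β ⊕ (γ ⊕ δ) → ℂ))))).choose
          (finrank ℂ 𝔟 - finrank ℂ ↥(𝔟 ⊓ AnalyticGroupModel.linSpace ((H₀ : AddSubgroup _) : Set (β ⊕ (γ ⊕ δ) → ℂ)))) *
        ((fun σ => σ +ᵥ ((H₀ : AddSubgroup _) : Set (β ⊕ (γ ⊕ δ) → ℂ))) '' AnalyticGroupModel.multiples v S).ncard *
        D ^ ((thetaModel L cls κM H).coneDim ((H₀ : AddSubgroup _) : Set (β ⊕ (γ ⊕ δ) → ℂ)) - 1) ≤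
      (thetaModel L cls κM H).mainConst * D ^ Fintype.card (β ⊕ (γ ⊕ δ)) := by
  set M := thetaModel L cls κM H with hM
  have hP' : (rename (idxEquiv β γ δ).symm P).IsHomogeneous D := hP.rename_isHomogeneous
  have hF : M.F (rename (idxEquiv β γ δ).symm P) = thetaEval L cls κM P := funext (F_thetaModel_rename L cls κM H P)
  have hP0' : ∃ w, M.F (rename (idxEquiv β γ δ).symm P) w ≠ 0 := by rw [hF]; exact hP0
  have hdim : M.dim = Fintype.card (β ⊕ (γ ⊕ δ)) := rfl
  have hvan' : ∀ σ ∈ AnalyticGroupModel.sumset (AnalyticGroupModel.multiples v S) M.dim,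
      AnalyticGroupModel.VanishesToOrder 𝔟 (M.F (rename (idxEquiv β γ δ).symm P)) σ (M.dim * T + 1) := by
    intro σ hσ
    rw [AnalyticGroupModel.sumset_multiples, AnalyticGroupModel.mem_multiples_iff] at hσ
    obtain ⟨s, hs, rfl⟩ := hσ
    rw [hF]
    exact (AnalyticGroupModel.vanishesAlong_iff_vanishesToOrder _ _ _ _).mp (hvan s hs)
  obtain ⟨H₀, -, hirr, hv₀, hineq⟩ := M.zero_estimate 𝔟 (AnalyticGroupModel.multiples_finite v S)
    (AnalyticGroupModel.zero_mem_multiples v S) hP' hP0' hvan'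
  refine ⟨H₀, hirr, ?_, hineq⟩
  obtain ⟨v₀, hv₀⟩ := hv₀
  exact ⟨v₀, fun h hh => by rw [← hF]; exact hv₀ h hh⟩

/-! ### Counting cosets (port of the dictionary of `ZeroEstStdBridge.lean`) -/

omit [DecidableEq γ] in
/-- **`card{σ + exp⁻¹(G') ; σ ∈ Σ} = orbitCard`** for `Σ = {0, v, …, S v}` (family models).
[cite: Philippon1986, Thm. 2.1 (card((Σ+G')/G'))] -/
theorem ncard_image_vadd_multiples_eq_orbitCard (K : SubgroupDataC β γ δ cls κM) (v : β ⊕ (γ ⊕ δ) → ℂ) (S : ℕ) :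
    ((fun σ => σ +ᵥ ((preimageSubgroup L cls κM K : AddSubgroup (β ⊕ (γ ⊕ δ) → ℂ)) :
        Set (β ⊕ (γ ⊕ δ) → ℂ))) '' AnalyticGroupModel.multiples v S).ncard = orbitCard L cls κM K v S := by
  rw [AnalyticGroupModel.ncard_image_vadd_eq_ncard_image_mk _ (AnalyticGroupModel.multiples_finite v S),
    AnalyticGroupModel.image_mk_multiples]
  rfl

/-! ### The shape of the named fact, from the classification of closed irreducible subgroups -/

/-- **`philippon1986_std` for `(L cls, κ, β, γ, δ)` from the hard data and the classification of the
closed irreducible subgroups of `Lie M_κ,ℂ`** as the `exp⁻¹(H_{(A,C,Ξ)})` (hypothesis `hCL`: the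
subgroup as a set, its lineality space as `Lie`, and `dim Lie ≤ coneDim - 1`).
[cite: Philippon1986, Thm. 2.1] -/
theorem philippon_shape_of_classification (H : HardData (β := β) L cls κM)
    (hCL : ∀ H₀ : AddSubgroup (β ⊕ (γ ⊕ δ) → ℂ), (thetaModel L cls κM H).IsIrred (H₀ : Set (β ⊕ (γ ⊕ δ) → ℂ)) →
      ∃ K : SubgroupDataC β γ δ cls κM, (preimageSubgroup L cls κM K : Set (β ⊕ (γ ⊕ δ) → ℂ)) = H₀ ∧
        AnalyticGroupModel.linSpace ((H₀ : AddSubgroup _) : Set (β ⊕ (γ ⊕ δ) → ℂ)) = K.tangent ∧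
        finrank ℂ K.tangent + 1 ≤ (thetaModel L cls κM H).coneDim ((H₀ : AddSubgroup _) : Set (β ⊕ (γ ⊕ δ) → ℂ))) :
    ∃ c : ℝ, 0 < c ∧ ∀ (𝔟 : Submodule ℂ (β ⊕ (γ ⊕ δ) → ℂ)) (v : β ⊕ (γ ⊕ δ) → ℂ)
        (P : MvPolynomial (Option β × ThetaIdx γ δ) ℂ) (D S T : ℕ),
        0 < Module.finrank ℂ 𝔟 → 1 ≤ D → 1 ≤ S → P.IsHomogeneous D → (∃ w, thetaEval L cls κM P w ≠ 0) →
        (∀ s : ℕ, s ≤ Fintype.card (β ⊕ (γ ⊕ δ)) * S →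
          VanishesAlong 𝔟 (thetaEval L cls κM P) ((s : ℂ) • v) (Fintype.card (β ⊕ (γ ⊕ δ)) * T + 1)) →
        ∃ K : SubgroupDataC β γ δ cls κM,
          (∃ w₀, ∀ w ∈ K.tangent, thetaEval L cls κM P (w₀ + w) = 0) ∧
          (Nat.choose (T + (Module.finrank ℂ 𝔟 - Module.finrank ℂ ↥(𝔟 ⊓ K.tangent)))
              (Module.finrank ℂ 𝔟 - Module.finrank ℂ ↥(𝔟 ⊓ K.tangent)) : ℝ) *
            (orbitCard L cls κM K v S : ℝ) * (D : ℝ) ^ Module.finrank ℂ K.tangent ≤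
            c * (D : ℝ) ^ Fintype.card (β ⊕ (γ ⊕ δ)) := by
  set M := thetaModel L cls κM H with hM
  refine ⟨M.mainConst + 1, by positivity, ?_⟩
  intro 𝔟 v P D S T _ hD _ hP hP0 hvan
  obtain ⟨H₀, hirr, ⟨v₀, hv₀⟩, hineq⟩ := zero_estimate_theta L cls κM H 𝔟 v S T hP hP0 hvan
  obtain ⟨K, hKH, hlin, hdimK⟩ := hCL H₀ hirr
  refine ⟨K, ⟨v₀, fun w hw => hv₀ w ?_⟩, ?_⟩
  · -- `K.tangent ⊆ exp⁻¹(K) = H₀`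
    have : w ∈ (preimageSubgroup L cls κM K : Set (β ⊕ (γ ⊕ δ) → ℂ)) :=
      AddSubgroup.mem_sup_left (by exact hw)
    rw [hKH] at this
    exact this
  · -- the inequality, read through the dictionary
    set s := Module.finrank ℂ 𝔟 - Module.finrank ℂ ↥(𝔟 ⊓ K.tangent) with hs
    have hs' : Module.finrank ℂ 𝔟 - Module.finrank ℂ ↥(𝔟 ⊓ AnalyticGroupModel.linSpace ((H₀ : AddSubgroup _) : Set (β ⊕ (γ ⊕ δ) → ℂ))) = s := by
      rw [hs, hlin]
    have hcount : ((fun σ => σ +ᵥ ((H₀ : AddSubgroup _) : Set (β ⊕ (γ ⊕ δ) → ℂ))) '' AnalyticGroupModel.multiples v S).ncard =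
        orbitCard L cls κM K v S := by
      rw [← ncard_image_vadd_multiples_eq_orbitCard, hKH]
    rw [hs', hcount] at hineq
    -- `D^{dim K} ≤ D^{coneDim H₀ - 1}`
    have hpow : D ^ Module.finrank ℂ K.tangent ≤ D ^ (M.coneDim ((H₀ : AddSubgroup _) : Set (β ⊕ (γ ⊕ δ) → ℂ)) - 1) :=
      Nat.pow_le_pow_right hD (by omega)
    have hnat : (T + s).choose s * orbitCard L cls κM K v S * D ^ Module.finrank ℂ K.tangent ≤
        M.mainConst * D ^ Fintype.card (β ⊕ (γ ⊕ δ)) :=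
      (Nat.mul_le_mul_left _ hpow).trans hineq
    have hreal : ((T + s).choose s : ℝ) * (orbitCard L cls κM K v S : ℝ) * (D : ℝ) ^ Module.finrank ℂ K.tangent ≤
        (M.mainConst : ℝ) * (D : ℝ) ^ Fintype.card (β ⊕ (γ ⊕ δ)) := by exact_mod_cast hnat
    refine hreal.trans ?_
    have : (0 : ℝ) ≤ (D : ℝ) ^ Fintype.card (β ⊕ (γ ⊕ δ)) := by positivity
    nlinarith



/-! ### The hard data of the family theta embedding, supplied -/

section Hard

variable [DecidableEq β] [DecidableEq δ]

omit [DecidableEq β] [DecidableEq δ] in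
omit [DecidableEq 𝓙] in
/-- **The image theorem, reindexed by `Fin (N + 1)`.** [cite: NesterenkoPhilippon2001, Ch. 11 §2.1] -/
theorem hard_surj (x : Fin (nIdx β γ δ + 1) → ℂ)
    (hrel : ∀ (P : MvPolynomial (Fin (nIdx β γ δ + 1)) ℂ) (d : ℕ), P.IsHomogeneous d →
      (∀ w, eval (fun J => Θf L cls κM J w) P = 0) → eval x P = 0)
    (hb : ∃ u ∈ (Finset.univ : Finset (γ → Fin 3)).image
        (fun Mc => ∏ a : Option β, (X ((idxEquiv β γ δ).symm (a, (Mc, none))) : MvPolynomial _ ℂ)),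
      eval x u ≠ 0) :
    ∃ (c : ℂ) (w : β ⊕ (γ ⊕ δ) → ℂ), x = c • fun J => Θf L cls κM J w := by
  classical
  set e := idxEquiv β γ δ with he
  set x' : Option β × ThetaIdx γ δ → ℂ := fun J => x (e.symm J) with hx'
  have hx'rel : ∀ (P' : MvPolynomial (Option β × ThetaIdx γ δ) ℂ) (d : ℕ), P'.IsHomogeneous d →
      (∀ w, thetaEval L cls κM P' w = 0) → eval x' P' = 0 := by
    intro P' d hd h0
    have h := hrel (rename e.symm P') d hd.rename_isHomogeneous
      (fun w => by rw [eval_Θf_rename]; exact h0 w)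
    rwa [eval_rename] at h
  have hb' : ∃ M : Option β → (γ → Fin 3), eval x' (bdryForm (δ := δ) M) ≠ 0 := by
    obtain ⟨u, hu, hne⟩ := hb
    obtain ⟨Mc, -, rfl⟩ := Finset.mem_image.mp hu
    refine ⟨fun _ => Mc, ?_⟩
    rw [eval_bdryForm]
    rw [eval_prod] at hne
    simpa [hx'] using hne
  obtain ⟨c, w, hxw⟩ := theta_surj' L cls κM x' hx'rel hb'
  refine ⟨c, w, funext fun J => ?_⟩
  have h := congr_fun hxw (e J)
  simp only [hx', Equiv.symm_apply_apply, Pi.smul_apply, thetaVec_apply, smul_eq_mul] at h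
  simpa [Θf] using h

omit [DecidableEq β] [DecidableEq δ] in
omit [DecidableEq 𝓙] in
/-- **The Jacobian criterion, reindexed by `Fin (N + 1)`.** [cite: NesterenkoPhilippon2001, Ch. 11 §2.2 (i)] -/
theorem hard_locRel (w : β ⊕ (γ ⊕ δ) → ℂ) :
    ∃ S : Finset (MvPolynomial (Fin (nIdx β γ δ + 1)) ℂ),
      (∀ P ∈ S, ∃ d, P.IsHomogeneous d) ∧ (∀ P ∈ S, ∀ w', eval (fun J => Θf L cls κM J w') P = 0) ∧
      S.card + Fintype.card (β ⊕ (γ ⊕ δ)) = nIdx β γ δ ∧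
      LinearIndependent ℂ fun P : S => fun J => eval (fun J' => Θf L cls κM J' w) (pderiv J (P : MvPolynomial _ ℂ)) := by
  classical
  obtain ⟨S, hhom, hvan, hcard, hli⟩ := theta_locRel L cls κM w
  set e := idxEquiv β γ δ with he
  set r : MvPolynomial (Option β × ThetaIdx γ δ) ℂ → MvPolynomial (Fin (nIdx β γ δ + 1)) ℂ :=
    fun P => rename e.symm P with hr
  have hrinj : Function.Injective r := rename_injective _ e.symm.injective
  have hkey : ∀ (P : MvPolynomial (Option β × ThetaIdx γ δ) ℂ) (J : Fin (nIdx β γ δ + 1)),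
      eval (fun J' => Θf L cls κM J' w) (pderiv J (r P)) = thetaEval L cls κM (pderiv (e J) P) w := by
    intro P J
    have hJ : pderiv J (r P) = pderiv (e.symm (e J)) (r P) := by rw [Equiv.symm_apply_apply]
    rw [hJ, hr, pderiv_rename e.symm.injective, eval_Θf_rename]
  refine ⟨S.image r, ?_, ?_, ?_, ?_⟩
  · intro P' hP'
    obtain ⟨P, hP, rfl⟩ := Finset.mem_image.mp hP'
    obtain ⟨d, hd⟩ := hhom P hP
    exact ⟨d, hd.rename_isHomogeneous⟩
  · intro P' hP' w'
    obtain ⟨P, hP, rfl⟩ := Finset.mem_image.mp hP'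
    rw [hr, eval_Θf_rename]
    exact hvan P hP w'
  · rw [Finset.card_image_of_injective _ hrinj]
    have := nIdx_succ β γ δ
    omega
  · -- reindex the independent family by `S ≃ S.image r` and transport along `e`
    let g : ↥S → ↥(S.image r) := fun P => ⟨r P.1, Finset.mem_image_of_mem r P.2⟩
    have hgb : Function.Bijective g := by
      constructor
      · intro P Q hPQ
        exact Subtype.ext (hrinj (congrArg Subtype.val hPQ))
      · rintro ⟨P', hP'⟩
        obtain ⟨P, hP, rfl⟩ := Finset.mem_image.mp hP'
        exact ⟨⟨P, hP⟩, rfl⟩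
    let E : ↥S ≃ ↥(S.image r) := Equiv.ofBijective g hgb
    have hcomp : ((fun P : ↥(S.image r) => fun J => eval (fun J' => Θf L cls κM J' w) (pderiv J (P : MvPolynomial _ ℂ))) ∘ E) =
        (LinearEquiv.funCongrLeft ℂ ℂ e) ∘ fun P : ↥S => fun J' => thetaEval L cls κM (pderiv J' (P : MvPolynomial _ ℂ)) w := by
      funext P
      funext J
      simp only [Function.comp_apply, LinearEquiv.funCongrLeft_apply, LinearMap.funLeft_apply]
      exact hkey P.1 J
    have hli' : LinearIndependent ℂ ((LinearEquiv.funCongrLeft ℂ ℂ e) ∘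
        fun P : ↥S => fun J' => thetaEval L cls κM (pderiv J' (P : MvPolynomial _ ℂ)) w) :=
      hli.map' (LinearEquiv.funCongrLeft ℂ ℂ e).toLinearMap (LinearEquiv.ker _)
    rw [← hcomp] at hli'
    exact (linearIndependent_equiv E).mp hli'

omit [DecidableEq β] [DecidableEq δ] in
omit [DecidableEq 𝓙] in
/-- **One non-degenerate point, reindexed by `Fin (N + 1)`.** [cite: NesterenkoPhilippon2001, Ch. 11 §2.2 (i)] -/
theorem hard_nondeg : ∃ (w₀ : β ⊕ (γ ⊕ δ) → ℂ) (J₀ : Fin (nIdx β γ δ + 1))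
      (Js : Fin (Fintype.card (β ⊕ (γ ⊕ δ))) → Fin (nIdx β γ δ + 1)), Θf L cls κM J₀ w₀ ≠ 0 ∧
    ∀ x : β ⊕ (γ ⊕ δ) → ℂ,
      (∀ i, deriv (fun t : ℂ => Θf L cls κM (Js i) (w₀ + t • x) / Θf L cls κM J₀ (w₀ + t • x)) 0 = 0) → x = 0 := by
  obtain ⟨w₀, J₀, Js, h0, h⟩ := exists_nondeg_point L cls κM
  set e := idxEquiv β γ δ with he
  refine ⟨w₀, e.symm J₀, fun i => e.symm (Js ((Fintype.equivFin _).symm i)), by simpa [Θf, he] using h0,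
    fun x hx => h x fun k => ?_⟩
  have := hx (Fintype.equivFin _ k)
  simpa [Θf, he] using this

/-- **The Wronskian forms, reindexed by `Fin (N + 1)`.** [cite: NesterenkoPhilippon2001, Ch. 11 Lemma 3.1] -/
def wronskf (x : β ⊕ (γ ⊕ δ) → ℂ) (I J : Fin (nIdx β γ δ + 1)) :
    MvPolynomial (Fin (nIdx β γ δ + 1)) ℂ :=
  rename (idxEquiv β γ δ).symm (wronsk L cls κM x (idxEquiv β γ δ I) (idxEquiv β γ δ J))

omit [DecidableEq 𝓙] in
/-- The reindexed Wronskian forms are quadratic. [folklore] -/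
theorem wronskf_isHomogeneous (x : β ⊕ (γ ⊕ δ) → ℂ) (I J : Fin (nIdx β γ δ + 1)) :
    (wronskf L cls κM x I J).IsHomogeneous 2 :=
  (wronsk_isHomogeneous L cls κM x _ _).rename_isHomogeneous

omit [DecidableEq 𝓙] in
/-- `Θ_J ∂_xΘ_I - Θ_I ∂_xΘ_J = Q_{x,I,J}(Θ)` for the reindexed forms. [cite: NesterenkoPhilippon2001, Ch. 11 Lemma 3.1] -/
theorem F_wronskf (x : β ⊕ (γ ⊕ δ) → ℂ) (I J : Fin (nIdx β γ δ + 1)) (w : β ⊕ (γ ⊕ δ) → ℂ) :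
    Θf L cls κM J w * deriv (fun t : ℂ => Θf L cls κM I (w + t • x)) 0 -
        Θf L cls κM I w * deriv (fun t : ℂ => Θf L cls κM J (w + t • x)) 0 =
      eval (fun K => Θf L cls κM K w) (wronskf L cls κM x I J) := by
  rw [wronskf, eval_Θf_rename, ← F_wronsk]
  rfl

/-- **The hard geometric data of the family theta embedding, PROVED** (image theorem,
Jacobian criterion, non-degenerate point, Wronskian forms: `ManyCurveThetaTangent.lean`,
`ManyCurveThetaWronskian.lean`). [cite: NesterenkoPhilippon2001, Ch. 11 §2.1–§2.3, Lemma 3.1] -/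
def hardData : HardData (β := β) L cls κM where
  surj := hard_surj L cls κM
  locRel := hard_locRel L cls κM
  nondeg := hard_nondeg L cls κM
  wronsk := wronskf L cls κM
  isHomogeneous_wronsk := wronskf_isHomogeneous L cls κM
  F_wronsk := F_wronskf L cls κM

/-- **Philippon's zero estimate for the family theta model in the shape of `philippon1986_std`,
granted only the classification of the closed irreducible subgroups** (the hard geometric data
being proved). [cite: Philippon1986, Thm. 2.1] [cite: NesterenkoPhilippon2001, Ch. 11 Thm. 4.1] -/
theorem philippon_shape_of_classification'
    (hCL : ∀ H₀ : AddSubgroup (β ⊕ (γ ⊕ δ) → ℂ),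
      (thetaModel L cls κM (hardData L cls κM)).IsIrred (H₀ : Set (β ⊕ (γ ⊕ δ) → ℂ)) →
      ∃ K : SubgroupDataC β γ δ cls κM, (preimageSubgroup L cls κM K : Set (β ⊕ (γ ⊕ δ) → ℂ)) = H₀ ∧
        AnalyticGroupModel.linSpace ((H₀ : AddSubgroup _) : Set (β ⊕ (γ ⊕ δ) → ℂ)) = K.tangent ∧
        finrank ℂ K.tangent + 1 ≤
          (thetaModel L cls κM (hardData L cls κM)).coneDim ((H₀ : AddSubgroup _) : Set (β ⊕ (γ ⊕ δ) → ℂ))) :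
    ∃ c : ℝ, 0 < c ∧ ∀ (𝔟 : Submodule ℂ (β ⊕ (γ ⊕ δ) → ℂ)) (v : β ⊕ (γ ⊕ δ) → ℂ)
        (P : MvPolynomial (Option β × ThetaIdx γ δ) ℂ) (D S T : ℕ),
        0 < Module.finrank ℂ 𝔟 → 1 ≤ D → 1 ≤ S → P.IsHomogeneous D → (∃ w, thetaEval L cls κM P w ≠ 0) →
        (∀ s : ℕ, s ≤ Fintype.card (β ⊕ (γ ⊕ δ)) * S →
          VanishesAlong 𝔟 (thetaEval L cls κM P) ((s : ℂ) • v) (Fintype.card (β ⊕ (γ ⊕ δ)) * T + 1)) →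
        ∃ K : SubgroupDataC β γ δ cls κM,
          (∃ w₀, ∀ w ∈ K.tangent, thetaEval L cls κM P (w₀ + w) = 0) ∧
          (Nat.choose (T + (Module.finrank ℂ 𝔟 - Module.finrank ℂ ↥(𝔟 ⊓ K.tangent)))
              (Module.finrank ℂ 𝔟 - Module.finrank ℂ ↥(𝔟 ⊓ K.tangent)) : ℝ) *
            (orbitCard L cls κM K v S : ℝ) * (D : ℝ) ^ Module.finrank ℂ K.tangent ≤
            c * (D : ℝ) ^ Fintype.card (β ⊕ (γ ⊕ δ)) :=
  philippon_shape_of_classification L cls κM (hardData L cls κM) hCL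

end Hard

end Std

end GaGmEFam

end Literature.NumberTheory.Transcendental

end
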